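import Summits.CriticalPhenomena.PercolationContinuityZ3.Theorems.Transplant.SharpnessSeriesLaw
import Summits.CriticalPhenomena.PercolationContinuityZ3.Theorems.Transplant.SharpnessSubdividedCluster
import Summits.CriticalPhenomena.PercolationContinuityZ3.Theorems.Transplant.SharpnessHalfSpaceNotQuasiTransitive
import Summits.CriticalPhenomena.PercolationContinuityZ3.Theorems.Transplant.SharpnessGridWalks
import Literature.Probability.Percolation.KestenTheoremProofs
import Literature.Probability.Percolation.GrimmettMarstrand
import Literature.Barriers.CriticalPhenomena.SubexponentialGrowthZd
import Mathlib.Analysis.SpecialFunctions.Pow.Real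
import HarnessLib

/-!
# The subdivided square lattice `ℤ²[L_M]`: `θ(p) = θ_{ℤ²}(p^M)`, `p_c = 2^{-1/M}`, continuity, quasi-transitivity

House module of the `TransplantSharpness` programme (sharpness desk, row 84 of the table).  `ℤ²[L_M]`,
`L_M = gridLines M` (`SharpnessGridWedge`), is the square lattice with every edge subdivided into `M` edges in
series, realised inside `ℤ²`; it is the QUASI-TRANSITIVE sandwich partner of the gridded wedge
`G′_M = ℤ²[W ∪ L_M]` of row 83 (`W ⊆ G′_M ⊇ ℤ²[L_M]`).  Kernel statements:

* `theta_subdividedLattice_eq` — `θ_{ℤ²[L_M]}(0, p) = θ_{ℤ²}(0, p^M)` for every `p` and `M ≥ 1`: the series law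
  (`bondPercolation_map_coarseConfig`, `SharpnessSeriesLaw`) composed with the deterministic identity of events
  (`percolatesVia_gridLines_eq`, `SharpnessSubdividedCluster`) and `θ_{G[R]} = P(0 ↔ ∞ in R)` (Literature
  `theta_induce_eq_real_percolatesVia`);
* `criticalProb_subdividedLattice_eq` — `p_c(ℤ²[L_M]) = (1/2)^{1/M}` (Kesten `p_c(ℤ²) = ½`, Harris–Kesten
  `θ_{ℤ²}(p) = 0 ⟺ p ≤ ½` in the tree), with `½ < p_c < 1` for `M ≥ 2`;
* `theta_subdividedLattice_criticalProb_eq_zero` — CONTINUITY at its own critical point, `θ(p_c) = θ_{ℤ²}(½) = 0`;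
* `subdividedLattice_isQuasiTransitive` — `ℤ²[L_M]` is quasi-transitive (translations by `M ℤ²`); `subdividedLattice_not_vertexTransitive`
  — but not vertex-transitive (`M ≥ 2`: degrees `4` at junctions, `2` inside walls);
* `exists_subdividedLattice_criticalProb_gt` — for every `ε > 0` a planar quasi-transitive `ℤ²[L_M]` with
  `1 - ε < p_c < 1` and `θ(p_c) = 0`;
* `criticalProb_gridWedge_le_rpow` / `_le_min` / `_lt_wedge_of_rpow_lt` — the sandwich bound `p_c(G′_M) ≤ min(p_c(W), (1/2)^{1/M})`
  for the gridded wedge and the grid-driven regime `p_c(G′_M) < p_c(W)` when `(1/2)^{1/M} < p_c(W)`.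

So `ℤ²[L_M]` is a planar quasi-transitive (not vertex-transitive) graph with an explicitly computed critical point
in `(½, 1)` at which `θ` is continuous — a positive instance of the Benjamini–Schramm continuity conjecture beside
the non-quasi-transitive counterexample `G′_M` of row 83 (`SharpnessGridFinal`).
-/

noncomputable section

namespace Summit.CriticalPhenomena.PercolationContinuityZ3.Theorems.TransplantSharpness

open MeasureTheory Literature.Probability.Percolation Literature.Probability.LatticeModels
open Literature.Barriers.CriticalPhenomena (IsQuasiTransitive logWedgeGraph logWedgeOrigin LogWedgePercolatingAtCriticality_holds)

/-! ## `θ_{ℤ²[L_M]}(0, p) = θ_{ℤ²}(0, p^M)` -/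

/-- **The percolation probability of the `M`-subdivided square lattice**: `θ_{ℤ²[L_M]}(0, p) = θ_{ℤ²}(0, p^M)`
(`M ≥ 1`; `M` edges in series are one edge of density `p^M`). [folklore] -/
theorem theta_subdividedLattice_eq {M : ℕ} (hM : 1 ≤ M) (p : unitInterval) :
    theta ((zdGraph 2).induce (gridLines M)) ⟨0, zero_mem_gridLines M⟩ p = theta (zdGraph 2) (0 : Site 2) (p ^ M) := by
  rw [theta_induce_eq_real_percolatesVia (zdGraph 2) (gridLines M) 0 (zero_mem_gridLines M) p,
    percolatesVia_gridLines_eq hM,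
    bondPercolation_real_preimage_coarseConfig p M (measurableSet_percolatesAt_holds (0 : Site 2))]
  rfl

/-- `θ_{ℤ²[L_M]}(0, p) > 0 ⟺ p^M > ½` (Harris–Kesten for `ℤ²`). [folklore] -/
theorem theta_subdividedLattice_pos_iff {M : ℕ} (hM : 1 ≤ M) (p : unitInterval) :
    0 < theta ((zdGraph 2).induce (gridLines M)) ⟨0, zero_mem_gridLines M⟩ p ↔ 1 / 2 < (p : ℝ) ^ M := by
  rw [theta_subdividedLattice_eq hM]
  constructor
  · intro h
    by_contra hle
    rw [not_lt] at hle
    have h0 := Kesten1980_theta_eq_zero (p ^ M) (by rwa [Set.Icc.coe_pow])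
    rw [h0] at h
    exact lt_irrefl _ h
  · intro h
    exact Kesten1980_theta_pos_holds (p ^ M) (by rwa [Set.Icc.coe_pow])

/-! ## The critical point `p_c(ℤ²[L_M]) = (1/2)^{1/M}` -/

/-- `0 < (1/2)^{1/M} < 1` for `M ≥ 1`, and `((1/2)^{1/M})^M = 1/2`. [folklore] -/
theorem rpow_half_facts {M : ℕ} (hM : 1 ≤ M) :
    0 < (1 / 2 : ℝ) ^ ((1 : ℝ) / M) ∧ (1 / 2 : ℝ) ^ ((1 : ℝ) / M) < 1 ∧ ((1 / 2 : ℝ) ^ ((1 : ℝ) / M)) ^ M = 1 / 2 := by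
  have hMpos : (0 : ℝ) < M := by exact_mod_cast hM
  refine ⟨Real.rpow_pos_of_pos (by norm_num) _, Real.rpow_lt_one (by norm_num) (by norm_num) (by positivity), ?_⟩
  rw [← Real.rpow_natCast, ← Real.rpow_mul (by norm_num)]
  rw [show (1 : ℝ) / M * M = 1 by field_simp]
  exact Real.rpow_one _

/-- **The critical point of the `M`-subdivided square lattice is `(1/2)^{1/M}`** (`M ≥ 1`). [folklore] -/
theorem criticalProb_subdividedLattice_eq {M : ℕ} (hM : 1 ≤ M) :
    criticalProb ((zdGraph 2).induce (gridLines M)) ⟨0, zero_mem_gridLines M⟩ = (1 / 2 : ℝ) ^ ((1 : ℝ) / M) := by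
  obtain ⟨hc0, hc1, hcM⟩ := rpow_half_facts hM
  set c : ℝ := (1 / 2 : ℝ) ^ ((1 : ℝ) / M) with hc
  set G := (zdGraph 2).induce (gridLines M) with hG
  set o : gridLines M := ⟨0, zero_mem_gridLines M⟩ with ho
  apply le_antisymm
  · -- `p_c ≤ q` for every `q > c`
    apply le_of_forall_gt_imp_ge_of_dense
    intro q hq
    by_cases hq1 : q ≤ 1
    · have hqI : q ∈ unitInterval := ⟨hc0.le.trans hq.le, hq1⟩
      have hpos : 0 < theta G o ⟨q, hqI⟩ := by
        rw [theta_subdividedLattice_pos_iff hM, ← hcM]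
        exact pow_lt_pow_left₀ hq hc0.le (by omega)
      refine csInf_le ⟨0, ?_⟩ (Or.inl ⟨hqI, hpos⟩)
      rintro r (⟨hr, -⟩ | hr)
      · exact hr.1
      · rw [Set.mem_singleton_iff] at hr
        rw [hr]; exact zero_le_one
    · exact (criticalProb_mem_Icc G o).2.trans (le_of_not_ge hq1)
  · -- every parameter with `θ > 0` exceeds `c`
    refine le_csInf ⟨1, Or.inr rfl⟩ ?_
    rintro r (⟨hr, hpos⟩ | hr)
    · rw [theta_subdividedLattice_pos_iff hM] at hpos
      by_contra hlt
      rw [not_le] at hlt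
      have : (r : ℝ) ^ M ≤ c ^ M := pow_le_pow_left₀ hr.1 hlt.le M
      rw [hcM] at this
      exact absurd (lt_of_lt_of_le hpos this) (lt_irrefl _)
    · rw [Set.mem_singleton_iff] at hr
      rw [hr]; exact hc1.le

/-- **`½ < p_c(ℤ²[L_M]) < 1` for `M ≥ 2`.** [folklore] -/
theorem criticalProb_subdividedLattice_mem_Ioo {M : ℕ} (hM : 2 ≤ M) :
    criticalProb ((zdGraph 2).induce (gridLines M)) ⟨0, zero_mem_gridLines M⟩ ∈ Set.Ioo (1 / 2 : ℝ) 1 := by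
  have hM1 : 1 ≤ M := by omega
  obtain ⟨-, hc1, -⟩ := rpow_half_facts hM1
  rw [criticalProb_subdividedLattice_eq hM1]
  refine ⟨?_, hc1⟩
  have hlt : (1 : ℝ) / M < 1 := by
    rw [div_lt_one (by positivity)]
    exact_mod_cast hM
  have h := Real.rpow_lt_rpow_of_exponent_gt (by norm_num : (0 : ℝ) < 1 / 2) (by norm_num) hlt
  rwa [Real.rpow_one] at h

/-- **Continuity of `θ_{ℤ²[L_M]}` at its own critical point**: `θ_{ℤ²[L_M]}(0, p_c) = θ_{ℤ²}(0, ½) = 0` (`M ≥ 1`).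
[folklore] -/
theorem theta_subdividedLattice_criticalProb_eq_zero {M : ℕ} (hM : 1 ≤ M) :
    theta ((zdGraph 2).induce (gridLines M)) ⟨0, zero_mem_gridLines M⟩
      ⟨criticalProb ((zdGraph 2).induce (gridLines M)) ⟨0, zero_mem_gridLines M⟩, criticalProb_mem_Icc _ _⟩ = 0 := by
  obtain ⟨-, -, hcM⟩ := rpow_half_facts hM
  rw [theta_subdividedLattice_eq hM]
  apply Kesten1980_theta_eq_zero
  rw [Set.Icc.coe_pow]
  simp only [criticalProb_subdividedLattice_eq hM]
  rw [hcM]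

/-! ## Quasi-transitivity of `ℤ²[L_M]` -/

/-- Translation by a vector of `M ℤ²` preserves the grid lines. [folklore] -/
theorem mem_gridLines_add_smul_iff (M : ℕ) (a x : Site 2) : x + (M : ℤ) • a ∈ gridLines M ↔ x ∈ gridLines M := by
  simp only [gridLines, Set.mem_setOf_eq, Pi.add_apply, Pi.smul_apply, smul_eq_mul]
  rw [dvd_add_left (dvd_mul_right _ _), dvd_add_left (dvd_mul_right _ _)]

/-- The translation of `ℤ²[L_M]` by `M a` as a graph automorphism (house construction). -/
def gridLinesShift (M : ℕ) (a : Site 2) : (zdGraph 2).induce (gridLines M) ≃g (zdGraph 2).induce (gridLines M) where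
  toEquiv := (Site.shift ((M : ℤ) • a)).subtypeEquiv fun x => (mem_gridLines_add_smul_iff M a x).symm
  map_rel_iff' := by
    intro x y
    simp only [SimpleGraph.comap_adj, Function.Embedding.coe_subtype, Equiv.subtypeEquiv_apply]
    exact zdGraph_adj_shift_iff _ _ _

/-- **`ℤ²[L_M]` is quasi-transitive** (`M ≥ 1`): every vertex is carried by a translation of `M ℤ²` into the
finite window `[0, M)²`. [folklore] -/
theorem subdividedLattice_isQuasiTransitive {M : ℕ} (hM : 1 ≤ M) : IsQuasiTransitive ((zdGraph 2).induce (gridLines M)) := by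
  classical
  have hfin : {v : gridLines M | (v : Site 2) ∈ Set.Icc (0 : Site 2) (fun _ => (M : ℤ))}.Finite :=
    (Set.finite_Icc (0 : Site 2) (fun _ => (M : ℤ))).preimage Subtype.val_injective.injOn
  refine ⟨hfin.toFinset, fun v => ?_⟩
  -- translate `v` by `-M ⌊v / M⌋` coordinatewise
  refine ⟨gridLinesShift M (fun k => -((v : Site 2) k / M)), ?_⟩
  rw [Set.Finite.mem_toFinset]
  have hMpos : (0 : ℤ) < M := by exact_mod_cast hM
  constructor
  · intro k
    show (0 : ℤ) ≤ (v : Site 2) k + (M : ℤ) * -((v : Site 2) k / M)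
    have := Int.emod_nonneg ((v : Site 2) k) hMpos.ne'
    rw [Int.emod_def] at this
    linarith
  · intro k
    show (v : Site 2) k + (M : ℤ) * -((v : Site 2) k / M) ≤ M
    have := Int.emod_lt_of_pos ((v : Site 2) k) hMpos
    rw [Int.emod_def] at this
    linarith

/-! ## The sandwich bound for the gridded wedge -/

/-- **`p_c(G′_M) ≤ (1/2)^{1/M}`**: the gridded wedge `ℤ²[W ∪ L_M]` contains the subdivided lattice `ℤ²[L_M]`, so it
percolates no later (`M ≥ 1`; `criticalProb_induce_anti`). [folklore] -/
theorem criticalProb_gridWedge_le_rpow (a b : ℝ) {M : ℕ} (hM : 1 ≤ M) :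
    criticalProb (gridWedgeGraph a b M) (gridWedgeOrigin a b M) ≤ (1 / 2 : ℝ) ^ ((1 : ℝ) / M) := by
  rw [← criticalProb_subdividedLattice_eq hM]
  exact criticalProb_induce_anti theta_induce_mono_holds (zdGraph 2) (gridLines_subset_gridWedge a b M) 0
    (zero_mem_gridLines M)

/-- `θ_{ℤ²[L_M]}(0, p) ≤ θ_{G′_M}(o, p)`: the gridded wedge percolates at least as well as the subdivided lattice.
[folklore] -/
theorem theta_subdividedLattice_le_theta_gridWedge (a b : ℝ) (M : ℕ) (p : unitInterval) :
    theta ((zdGraph 2).induce (gridLines M)) ⟨0, zero_mem_gridLines M⟩ p ≤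
      theta (gridWedgeGraph a b M) (gridWedgeOrigin a b M) p :=
  theta_induce_mono_holds (zdGraph 2) (gridLines_subset_gridWedge a b M) 0 (zero_mem_gridLines M) p

/-- **The two-sided sandwich bound**: `p_c(G′_M) ≤ min (p_c(W)) ((1/2)^{1/M})` for every `M ≥ 1` (`W ⊆ G′_M ⊇ ℤ²[L_M]`).
[folklore] -/
theorem criticalProb_gridWedge_le_min (a b : ℝ) {M : ℕ} (hM : 1 ≤ M) :
    criticalProb (gridWedgeGraph a b M) (gridWedgeOrigin a b M) ≤
      min (criticalProb (logWedgeGraph a b) (logWedgeOrigin a b)) ((1 / 2 : ℝ) ^ ((1 : ℝ) / M)) :=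
  le_min (criticalProb_gridWedge_le a b M) (criticalProb_gridWedge_le_rpow a b hM)

/-- **The grid-driven regime**: if the mesh is so coarse that `(1/2)^{1/M} < p_c(W)`, then the gridded wedge percolates
STRICTLY before the wedge does, `p_c(G′_M) < p_c(W)` — the complement of the regime of `SharpnessGridFinal` (large even
`M`, where `p_c(G′_M) = p_c(W)`).  Whether `θ_{G′_M}` is continuous at `p_c(G′_M)` in this regime is open. [folklore] -/
theorem criticalProb_gridWedge_lt_wedge_of_rpow_lt (a b : ℝ) {M : ℕ} (hM : 1 ≤ M)
    (h : (1 / 2 : ℝ) ^ ((1 : ℝ) / M) < criticalProb (logWedgeGraph a b) (logWedgeOrigin a b)) :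
    criticalProb (gridWedgeGraph a b M) (gridWedgeOrigin a b M) < criticalProb (logWedgeGraph a b) (logWedgeOrigin a b) :=
  (criticalProb_gridWedge_le_rpow a b hM).trans_lt h

/-- **Summary (row 84)**: for `M ≥ 2` the `M`-subdivided square lattice `ℤ²[L_M]` is quasi-transitive, has
`p_c = (1/2)^{1/M} ∈ (½, 1)`, and does NOT percolate at its critical point. [folklore] -/
theorem subdividedLattice_continuous_at_criticalProb {M : ℕ} (hM : 2 ≤ M) :
    IsQuasiTransitive ((zdGraph 2).induce (gridLines M)) ∧
      criticalProb ((zdGraph 2).induce (gridLines M)) ⟨0, zero_mem_gridLines M⟩ = (1 / 2 : ℝ) ^ ((1 : ℝ) / M) ∧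
      criticalProb ((zdGraph 2).induce (gridLines M)) ⟨0, zero_mem_gridLines M⟩ ∈ Set.Ioo (1 / 2 : ℝ) 1 ∧
      theta ((zdGraph 2).induce (gridLines M)) ⟨0, zero_mem_gridLines M⟩
        ⟨criticalProb ((zdGraph 2).induce (gridLines M)) ⟨0, zero_mem_gridLines M⟩, criticalProb_mem_Icc _ _⟩ = 0 :=
  ⟨subdividedLattice_isQuasiTransitive (by omega), criticalProb_subdividedLattice_eq (by omega),
    criticalProb_subdividedLattice_mem_Ioo hM, theta_subdividedLattice_criticalProb_eq_zero (by omega)⟩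

/-- `(1/2)^{1/M} ≥ 1 - (log 2)/M` (`(1/2)^{1/M} = e^{-(log 2)/M}` and `1 + x ≤ e^x`). [folklore] -/
theorem one_sub_log_two_div_le_rpow_half {M : ℕ} (hM : 1 ≤ M) :
    1 - Real.log 2 / M ≤ (1 / 2 : ℝ) ^ ((1 : ℝ) / M) := by
  have hexp : (1 / 2 : ℝ) ^ ((1 : ℝ) / M) = Real.exp (-(Real.log 2) / M) := by
    rw [Real.rpow_def_of_pos (by norm_num : (0 : ℝ) < 1 / 2)]
    congr 1
    rw [one_div, Real.log_inv]
    ring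
  have _hM : (0 : ℝ) < M := by exact_mod_cast hM
  rw [hexp]
  have h1 : -(Real.log 2) / M + 1 ≤ Real.exp (-(Real.log 2) / M) := Real.add_one_le_exp _
  have h2 : -(Real.log 2) / (M : ℝ) = -(Real.log 2 / M) := neg_div _ _
  linarith

/-- **Planar quasi-transitive graphs, continuous at a critical point arbitrarily close to `1`**: for every `ε > 0`
some subdivided square lattice `ℤ²[L_M]` is quasi-transitive with `1 - ε < p_c < 1` and `θ(p_c) = 0`
(`(1/2)^{1/M} = e^{-(log 2)/M} ≥ 1 - (log 2)/M`). [folklore] -/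
theorem exists_subdividedLattice_criticalProb_gt (ε : ℝ) (hε : 0 < ε) :
    ∃ M : ℕ, 2 ≤ M ∧ IsQuasiTransitive ((zdGraph 2).induce (gridLines M)) ∧
      1 - ε < criticalProb ((zdGraph 2).induce (gridLines M)) ⟨0, zero_mem_gridLines M⟩ ∧
      criticalProb ((zdGraph 2).induce (gridLines M)) ⟨0, zero_mem_gridLines M⟩ < 1 ∧
      theta ((zdGraph 2).induce (gridLines M)) ⟨0, zero_mem_gridLines M⟩
        ⟨criticalProb ((zdGraph 2).induce (gridLines M)) ⟨0, zero_mem_gridLines M⟩, criticalProb_mem_Icc _ _⟩ = 0 := by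
  obtain ⟨M, hM⟩ := exists_nat_gt (max 2 (Real.log 2 / ε))
  have hM2 : 2 ≤ M := by
    have h := (le_max_left 2 (Real.log 2 / ε)).trans_lt hM
    exact_mod_cast h.le
  have hM1 : 1 ≤ M := by omega
  have hMpos : (0 : ℝ) < M := by exact_mod_cast hM1
  refine ⟨M, hM2, subdividedLattice_isQuasiTransitive hM1, ?_, (criticalProb_subdividedLattice_mem_Ioo hM2).2,
    theta_subdividedLattice_criticalProb_eq_zero hM1⟩
  rw [criticalProb_subdividedLattice_eq hM1]
  have hlogM : Real.log 2 / M < ε := by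
    rw [div_lt_iff₀ hMpos]
    have h := (le_max_right 2 (Real.log 2 / ε)).trans_lt hM
    rw [div_lt_iff₀ hε] at h
    linarith [mul_comm ε (M : ℝ)]
  have h := one_sub_log_two_div_le_rpow_half hM1
  linarith

/-! ## A zero-density enhancement that strictly lowers the critical point -/

/-- **If the wedge percolates before the grid, the gridded wedge percolates STRICTLY before the subdivided lattice**:
`p_c(W) < (1/2)^{1/M} ⇒ p_c(G′_M) < p_c(ℤ²[L_M])`. [folklore] -/
theorem criticalProb_gridWedge_lt_subdividedLattice_of_lt (a b : ℝ) {M : ℕ} (hM : 1 ≤ M)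
    (h : criticalProb (logWedgeGraph a b) (logWedgeOrigin a b) < (1 / 2 : ℝ) ^ ((1 : ℝ) / M)) :
    criticalProb (gridWedgeGraph a b M) (gridWedgeOrigin a b M) <
      criticalProb ((zdGraph 2).induce (gridLines M)) ⟨0, zero_mem_gridLines M⟩ := by
  rw [criticalProb_subdividedLattice_eq hM]
  exact (criticalProb_gridWedge_le a b M).trans_lt h

/-- **A zero-density enhancement is essential for every coarse mesh**: for `b > 2a > 0` and all large `M`, adding the
(density-zero) logarithmic wedge `W` to the quasi-transitive subdivided lattice `ℤ²[L_M]` STRICTLY lowers the critical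
point, `p_c(ℤ²[W ∪ L_M]) < p_c(ℤ²[L_M])` — because `p_c(W) < 1` (Grimmett Thm (11.55)) while `p_c(ℤ²[L_M]) = 2^{-1/M} → 1`.
(Aizenman–Grimmett's essential-enhancement theorem asks for a positive density of enhancements; here the enhancement
percolates by itself.) [folklore] -/
theorem criticalProb_gridWedge_lt_subdividedLattice_eventually {a b : ℝ} (ha : 0 < a) (hab : 2 * a < b) :
    ∃ M₀ : ℕ, ∀ M : ℕ, M₀ ≤ M →
      criticalProb (gridWedgeGraph a b M) (gridWedgeOrigin a b M) <
        criticalProb ((zdGraph 2).induce (gridLines M)) ⟨0, zero_mem_gridLines M⟩ := by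
  obtain ⟨-, hW1, -⟩ := LogWedgePercolatingAtCriticality_holds a b ha hab
  set c := criticalProb (logWedgeGraph a b) (logWedgeOrigin a b) with hc
  -- choose `M₀ > log 2 / (1 - c)`, so that `1 - (log 2)/M > c` for `M ≥ M₀`
  obtain ⟨M₀, hM₀⟩ := exists_nat_gt (max 1 (Real.log 2 / (1 - c)))
  refine ⟨M₀, fun M hM => ?_⟩
  have hM₀1 : (1 : ℝ) < M₀ := (le_max_left _ _).trans_lt hM₀
  have hM1 : 1 ≤ M := le_trans (by exact_mod_cast hM₀1.le) hM
  have hMpos : (0 : ℝ) < M := by exact_mod_cast hM1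
  apply criticalProb_gridWedge_lt_subdividedLattice_of_lt a b hM1
  have hlog : Real.log 2 / M < 1 - c := by
    rw [div_lt_iff₀ hMpos]
    have h := (le_max_right 1 (Real.log 2 / (1 - c))).trans_lt hM₀
    rw [div_lt_iff₀ (by linarith)] at h
    have hMM : (M₀ : ℝ) ≤ M := by exact_mod_cast hM
    nlinarith
  have h := one_sub_log_two_div_le_rpow_half hM1
  linarith

/-! ## `ℤ²[L_M]` is quasi-transitive but NOT vertex-transitive -/

/-- **`ℤ²[L_M]` is not vertex-transitive for `M ≥ 2`**: the junction `0` has `4` neighbours, the wall vertex `e₀` fewer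
(its neighbour `e₀ + e₁` is off the grid lines), and automorphisms preserve neighbour counts. [folklore] -/
theorem subdividedLattice_not_vertexTransitive {M : ℕ} (hM : 2 ≤ M) :
    ¬ ∀ u v : gridLines M, ∃ γ : (zdGraph 2).induce (gridLines M) ≃g (zdGraph 2).induce (gridLines M), γ u = v := by
  intro h
  have hMZ : (2 : ℤ) ≤ M := by exact_mod_cast hM
  -- neighbour counts in `ℤ²[S]`, seen in `ℤ²` (`ncard_neighborSet_induce_eq` of `SharpnessWedgeNotQuasiTransitive`, inlined)
  have hcount : ∀ v : gridLines M, (((zdGraph 2).induce (gridLines M)).neighborSet v).ncard =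
      {y | (zdGraph 2).Adj (v : Site 2) y ∧ y ∈ gridLines M}.ncard := by
    intro v
    have himg : Subtype.val '' (((zdGraph 2).induce (gridLines M)).neighborSet v) =
        {y | (zdGraph 2).Adj (v : Site 2) y ∧ y ∈ gridLines M} := by
      ext y
      simp only [Set.mem_image, SimpleGraph.mem_neighborSet, Set.mem_setOf_eq]
      constructor
      · rintro ⟨w, hw, rfl⟩
        exact ⟨(SimpleGraph.comap_adj).1 hw, w.2⟩
      · rintro ⟨hadj, hy⟩
        exact ⟨⟨y, hy⟩, (SimpleGraph.comap_adj).2 hadj, rfl⟩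
    rw [← himg, Set.ncard_image_of_injective _ Subtype.val_injective]
  have h1mem : (Pi.single 0 1 : Site 2) ∈ gridLines M := Or.inr (by simp)
  obtain ⟨γ, hγ⟩ := h ⟨0, zero_mem_gridLines M⟩ ⟨Pi.single 0 1, h1mem⟩
  -- the junction `0` has four neighbours
  have h4 : (((zdGraph 2).induce (gridLines M)).neighborSet ⟨0, zero_mem_gridLines M⟩).ncard = 2 * 2 := by
    rw [hcount]
    have : {y | (zdGraph 2).Adj ((⟨0, zero_mem_gridLines M⟩ : gridLines M) : Site 2) y ∧ y ∈ gridLines M} =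
        (zdGraph 2).neighborSet (0 : Site 2) := by
      ext y
      simp only [Set.mem_setOf_eq, SimpleGraph.mem_neighborSet, and_iff_left_iff_imp]
      intro hy
      obtain ⟨j, s, -, rfl⟩ := exists_step_of_adj hy
      fin_cases j
      · exact Or.inr (by simp)
      · exact Or.inl (by simp)
    rw [this, ← SimpleGraph.coe_neighborFinset, Set.ncard_coe_finset]
    exact card_neighborFinset_zdGraph_holds (0 : Site 2)
  -- the wall vertex `e₀` has fewer: `e₀ + e₁ ∉ L_M`
  have hadj : (zdGraph 2).Adj (Pi.single 0 1 : Site 2) (Pi.single 0 1 + Pi.single 1 1) :=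
    (zdGraph_adj_iff _ _).2 ⟨1, Or.inl rfl⟩
  have hout : (Pi.single 0 1 + Pi.single 1 1 : Site 2) ∉ gridLines M := by
    have h1 : ¬ (M : ℤ) ∣ 1 := fun hd => by
      have := Int.le_of_dvd one_pos hd
      omega
    rintro (h | h) <;> simp at h <;> exact h1 h
  have hlt : (((zdGraph 2).induce (gridLines M)).neighborSet ⟨Pi.single 0 1, h1mem⟩).ncard < 2 * 2 := by
    rw [hcount, ← card_neighborFinset_zdGraph_holds (Pi.single 0 1 : Site 2), ← Set.ncard_coe_finset,
      SimpleGraph.coe_neighborFinset]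
    refine Set.ncard_lt_ncard ?_ (SimpleGraph.neighborSet (zdGraph 2) (Pi.single 0 1 : Site 2)).toFinite
    exact ⟨fun z hz => hz.1, fun hsub => hout (hsub hadj).2⟩
  have heq := ncard_neighborSet_map γ (⟨0, zero_mem_gridLines M⟩ : gridLines M)
  rw [hγ, h4] at heq
  omega

/-! ## Independence of the root -/

/-- `ℤ²[L_M]` is connected (`M ≥ 1`). [folklore] -/
theorem subdividedLattice_reachable {M : ℕ} (hM : 1 ≤ M) (u v : gridLines M) :
    ((zdGraph 2).induce (gridLines M)).Reachable u v := by
  obtain ⟨u, hu⟩ := u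
  obtain ⟨v, hv⟩ := v
  have eu : u = ![u 0, u 1] := by ext k; fin_cases k <;> rfl
  have ev : v = ![v 0, v 1] := by ext k; fin_cases k <;> rfl
  have hu' : (![u 0, u 1] : Site 2) ∈ gridLines M := eu ▸ hu
  have hv' : (![v 0, v 1] : Site 2) ∈ gridLines M := ev ▸ hv
  obtain ⟨w, -⟩ := exists_walk_of_grid (S := gridLines M) hM (fun z hz => hz) hu' hv' hu' hv'
  have h1 : (⟨u, hu⟩ : gridLines M) = ⟨![u 0, u 1], hu'⟩ := Subtype.ext eu
  have h2 : (⟨v, hv⟩ : gridLines M) = ⟨![v 0, v 1], hv'⟩ := Subtype.ext ev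
  rw [h1, h2]
  exact ⟨w⟩

/-- **The critical point of `ℤ²[L_M]` does not depend on the root**: `p_c(ℤ²[L_M], v) = (1/2)^{1/M}` for every vertex
`v` (Grimmett Thm (2.8), `criticalProb_eq_of_reachable`). [folklore] -/
theorem criticalProb_subdividedLattice_eq_of_mem {M : ℕ} (hM : 1 ≤ M) (v : gridLines M) :
    criticalProb ((zdGraph 2).induce (gridLines M)) v = (1 / 2 : ℝ) ^ ((1 : ℝ) / M) := by
  rw [← criticalProb_subdividedLattice_eq hM]
  exact (criticalProb_eq_of_reachable _ (subdividedLattice_reachable hM ⟨0, zero_mem_gridLines M⟩ v)).symm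

/-- **`θ` at every junction**: `θ_{ℤ²[L_M]}(M x, p) = θ_{ℤ²}(0, p^M)` (translation by `M x` is an automorphism,
`theta_iso`). [folklore] -/
theorem theta_subdividedLattice_junction {M : ℕ} (hM : 1 ≤ M) (x : Site 2) (p : unitInterval) :
    theta ((zdGraph 2).induce (gridLines M))
        ⟨(M : ℤ) • x, (mem_gridLines_add_smul_iff M x 0).2 (zero_mem_gridLines M) |> fun h => by simpa using h⟩ p =
      theta (zdGraph 2) (0 : Site 2) (p ^ M) := by
  have h := theta_iso (gridLinesShift M x) ⟨0, zero_mem_gridLines M⟩ p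
  have hγ : (gridLinesShift M x ⟨0, zero_mem_gridLines M⟩ : gridLines M) =
      ⟨(M : ℤ) • x, (mem_gridLines_add_smul_iff M x 0).2 (zero_mem_gridLines M) |> fun h => by simpa using h⟩ := by
    apply Subtype.ext
    simp [gridLinesShift]
  rw [hγ] at h
  rw [h, theta_subdividedLattice_eq hM]

end Summit.CriticalPhenomena.PercolationContinuityZ3.Theorems.TransplantSharpness
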